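import Mathlib
import Summits.KontsevichZagierPeriods.Zeta5Search.WedgeDictionaryDiagData
import Summits.KontsevichZagierPeriods.Zeta5Search.WedgeDictionaryTopPairIntegral
import HarnessLib

/-!
# The last datum `D17` of gen-1's wedge dictionary is a THEOREM: `ExplicitPQAt (0,0,1,0,1,1,0,1) 2`
# (cell `pub-zeta5`, seat ct-1 g20)

HONEST FRAMING: systematic search; no irrationality claim unless certified.  OUR work (Summit side).

ct-1 g19's `WedgeDictionaryDiagData.explicitPQ_iff_diag2_top` reduced gen-1's wedge-dictionary conjecture `explicitPQ`
(every admissible `a`) to its two smallest DIAGONAL instances `a = 1⁸, 2⁸` and ONE level-1 value, the top-pair point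
`a = (0,0,1,0,1,1,0,1)` (dual coordinates `(1; 1,0,0,0,0,0,1)`, partner `j = 2`).  This file DISCHARGES that value:

* §1–§2 the dictionary side at the point, by the kernel: `b(a) = (1;1,0,0,0,0,0,1)`, `b′ = b + e₂`, explicit partial-fraction
  tables of `R_b(t) = (2t+3)/((t+1)(t+2))⁴` and `R_{b′}(t) = (2t+3)/((t+1)(t+2))³` (certified `IsPFData`, template
  `WedgeDictionaryInstances`), hence `(U, W, V)(b) = (0, −4, −5)`, `(U, W, V)(b′) = (0, 2, 2)`, `ρ(a) = 1/4`, `Q(a) = 0`,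
  `P̂_d(a,2) = 0`, `P_d(a,2) = −1/2` — the dictionary predicts `I(a) = 0·θ − 4·0·ζ(2) − 2·(−1/2) = 1`;
* §3 **`explicitPQAt_top17 : ExplicitPQAt ![0,0,1,0,1,1,0,1] 2`** — with the analytic value `I(a) = 1`
  (`WedgeDictionaryTopPairIntegral.cellularIntegral_top17`, elementary calculus);
* §4 consequences, all by modus ponens from the tree: **`explicitPQ_iff_diag2 : explicitPQ ↔ ExplicitPQAt 1⁸ 1 ∧ ExplicitPQAt 2⁸ 1`**
  (HYPOTHESIS-FREE: gen-1's wedge dictionary for every admissible `a` is EQUIVALENT to its two smallest diagonal instances, i.e.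
  to Brown–Zudilin's two displayed totally symmetric values `I₁`, `I₂` read as dictionary identities), `explicitPQ_iff_data2`
  (⟺ the two remaining level-1 values `D1`, `D2`), and **`explicitPQ_of_I_init : I_init → explicitPQ`**,
  `wedgeDictionary_of_I_init` — CONDITIONAL on the named Literature fact `BrownZudilin2022.I_init` EXACTLY as typed (the printed
  `I₁, I₂` of arXiv:2210.03391 Sect. 2, eq. (5), a HyperInt computation in the source), gen-1's wedge dictionary holds at every
  admissible `a`.  The recursion `I_solvesRec` is not used.

What this file is NOT: a proof of `I_init` (a weight-5 period computation), of `explicitPQ` unconditionally, or of anything about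
`ζ(5)`, a linear form, a denominator or an exponent; records in print are unmoved.
-/

noncomputable section

open Finset Polynomial

namespace Summit.KontsevichZagierPeriods.Zeta5Search.WedgeDictionaryTopPairDatum

open Summit.KontsevichZagierPeriods.Zeta5Search.WedgeDictionary
open Summit.KontsevichZagierPeriods.Zeta5Search.DualSeries
open Summit.KontsevichZagierPeriods.Zeta5Search.WedgeDictionaryTopPairIntegral (cellularIntegral_top17)
open Summit.KontsevichZagierPeriods.Zeta5Search.WedgeDictionaryData3 (explicitPQ_iff_data3)
open Summit.KontsevichZagierPeriods.Zeta5Search.WedgeDictionaryDiagData (explicitPQ_iff_diag2_top explicitPQ_of_I_init_top)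
open Literature.NumberTheory.Irrationality.BrownZudilin2022 (bOfA QOf cellularIntegral I_init)
open Literature.NumberTheory.Transcendental (zetaValue)
open Literature.NumberTheory.Transcendental.BallRivoal (pfEval harm)

/-! ## 1. Dual coordinates and partial-fraction tables at the top-pair point

The point, its dual coordinates and the two partial-fraction tables are LOCAL NOTATIONS (this file declares theorems only). -/

/-- The parameter vector `a = (0,0,1,0,1,1,0,1)`. -/
local notation "aTop" => (![0, 0, 1, 0, 1, 1, 0, 1] : Fin 8 → ℤ)

/-- `b = b(0,0,1,0,1,1,0,1) = (1; 1,0,0,0,0,0,1)`. -/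
local notation "bTop" => (fun j : ℕ => ite (j = 0) (1 : ℤ) (ite (j = 1) 1 (ite (j = 7) 1 0)))

/-- `b′ = b + e₂ = (1; 1,1,0,0,0,0,1)`. -/
local notation "bTop'" => (fun j : ℕ => ite (j = 0) (1 : ℤ) (ite (j = 1) 1 (ite (j = 2) 1 (ite (j = 7) 1 0))))

/-- `b(0,0,1,0,1,1,0,1) = (1; 1,0,0,0,0,0,1)`. [folklore] -/
theorem bOfA_aTop : bOfA aTop = bTop := by
  funext j
  match j with
  | 0 => rfl | 1 => rfl | 2 => rfl | 3 => rfl | 4 => rfl | 5 => rfl | 6 => rfl | 7 => rfl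
  | n + 8 => simp [bOfA]

/-- The partner shift `j = 2` of `b(a)` is `b′`. [folklore] -/
theorem update_bOfA_aTop : Function.update (bOfA aTop) 2 (bOfA aTop 2 + 1) = bTop' := by
  rw [bOfA_aTop]
  funext j
  by_cases hj : j = 2
  · subst hj; simp
  · rw [Function.update_of_ne hj]; simp [hj]

/-- Partial-fraction data of `R_b(t) = (2t+3)/((t+1)(t+2))⁴ = 2/(t+1)² − 2/(t+1)³ + 1/(t+1)⁴ − 2/(t+2)² − 2/(t+2)³ − 1/(t+2)⁴`. -/
local notation "cTop" => (fun o p : ℕ =>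
  ite (o = 1 ∧ p = 0) (2 : ℚ) (ite (o = 1 ∧ p = 1) (-2) (ite (o = 2 ∧ p = 0) (-2) (ite (o = 2 ∧ p = 1) (-2)
    (ite (o = 3 ∧ p = 0) 1 (ite (o = 3 ∧ p = 1) (-1) 0))))))

/-- Partial-fraction data of `R_{b′}(t) = (2t+3)/((t+1)(t+2))³ = −1/(t+1)² + 1/(t+1)³ + 1/(t+2)² + 1/(t+2)³`. -/
local notation "cTop'" => (fun o p : ℕ =>
  ite (o = 1 ∧ p = 0) (-1 : ℚ) (ite (o = 1 ∧ p = 1) 1 (ite (o = 2 ∧ p = 0) 1 (ite (o = 2 ∧ p = 1) 1 0))))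

/-- `numPoly_b(t+1) = (2t+3)((t+1)(t+2))²`. [folklore] -/
theorem eval_numPoly_bTop (t : ℚ) :
    ((numPoly bTop).comp (X + C 1)).eval t = (2 * t + 3) * ((t + 1) * (t + 2)) ^ 2 := by
  rw [eval_comp, eval_add, eval_X, eval_C, eval_numPoly]
  simp [prod_range_succ, Literature.NumberTheory.Transcendental.BallRivoal.poch]
  ring

/-- `numPoly_{b′}(t+1) = (2t+3)((t+1)(t+2))³`. [folklore] -/
theorem eval_numPoly_bTop' (t : ℚ) :
    ((numPoly bTop').comp (X + C 1)).eval t = (2 * t + 3) * ((t + 1) * (t + 2)) ^ 3 := by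
  rw [eval_comp, eval_add, eval_X, eval_C, eval_numPoly]
  simp [prod_range_succ, Literature.NumberTheory.Transcendental.BallRivoal.poch]
  ring

/-- `cTop` is THE partial-fraction data of `R_b`. [folklore] -/
theorem isPFData_bTop : IsPFData bTop cTop := by
  intro t ht
  have hB : (bTop 0).toNat = 1 := by decide
  rw [hB] at ht ⊢
  have h1 : t + 1 ≠ 0 := by have := ht 0 (by norm_num); simpa using this
  have h2 : t + 2 ≠ 0 := by have := ht 1 (by norm_num); intro h; apply this; push_cast; linarith
  rw [eval_numPoly_bTop, poch_two]
  simp only [pfEval, sum_range_succ, sum_range_zero]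
  norm_num
  rw [show t + 1 + 1 = t + 2 by ring]
  field_simp
  ring

/-- `cTop'` is THE partial-fraction data of `R_{b′}`. [folklore] -/
theorem isPFData_bTop' : IsPFData bTop' cTop' := by
  intro t ht
  have hB : (bTop' 0).toNat = 1 := by decide
  rw [hB] at ht ⊢
  have h1 : t + 1 ≠ 0 := by have := ht 0 (by norm_num); simpa using this
  have h2 : t + 2 ≠ 0 := by have := ht 1 (by norm_num); intro h; apply this; push_cast; linarith
  rw [eval_numPoly_bTop', poch_two]
  simp only [pfEval, sum_range_succ, sum_range_zero]
  norm_num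
  rw [show t + 1 + 1 = t + 2 by ring]
  field_simp
  ring

/-! ## 2. The canonical coefficients and the dictionary vector `(Q, P̂_d, P_d) = (0, 0, −1/2)` -/

/-- `(U, W, V)(1;1,0,0,0,0,0,1) = (0, −4, −5)`. [folklore] -/
theorem coeff_bTop : coeffU bTop = 0 ∧ coeffW bTop = -4 ∧ coeffV bTop = -5 := by
  have hB : (bTop 0).toNat = 1 := by decide
  refine ⟨?_, ?_, ?_⟩
  · rw [coeffU_eq isPFData_bTop, hB]; simp only [sum_range_succ, sum_range_zero]; norm_num
  · rw [coeffW_eq isPFData_bTop, hB]; simp only [sum_range_succ, sum_range_zero]; norm_num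
  · rw [coeffV_eq isPFData_bTop, hB]; simp only [sum_range_succ, sum_range_zero, harm]; norm_num

/-- `(U, W, V)(1;1,1,0,0,0,0,1) = (0, 2, 2)`. [folklore] -/
theorem coeff_bTop' : coeffU bTop' = 0 ∧ coeffW bTop' = 2 ∧ coeffV bTop' = 2 := by
  have hB : (bTop' 0).toNat = 1 := by decide
  refine ⟨?_, ?_, ?_⟩
  · rw [coeffU_eq isPFData_bTop', hB]; simp only [sum_range_succ, sum_range_zero]; norm_num
  · rw [coeffW_eq isPFData_bTop', hB]; simp only [sum_range_succ, sum_range_zero]; norm_num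
  · rw [coeffV_eq isPFData_bTop', hB]; simp only [sum_range_succ, sum_range_zero, harm]; norm_num

/-- `Q(0,0,1,0,1,1,0,1) = 0` (the binomial sum (17), by the kernel). [folklore] -/
theorem QOf_aTop : QOf aTop = 0 := by decide

/-- `ρ(0,0,1,0,1,1,0,1) = 1/4`. [folklore] -/
theorem rhoOf_aTop : rhoOf aTop = 1 / 4 := by decide +kernel

/-- `P̂_d(a, 2) = ρ·(UV′ − U′V) = 0`. [folklore] -/
theorem dictPhat_aTop : dictPhat aTop 2 = 0 := by
  unfold dictPhat
  rw [update_bOfA_aTop, bOfA_aTop, rhoOf_aTop, coeff_bTop.1, coeff_bTop'.1, coeff_bTop.2.2, coeff_bTop'.2.2]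
  norm_num

/-- `P_d(a, 2) = ρ·(W′V − WV′) = (1/4)·(2·(−5) − (−4)·2) = −1/2`. [folklore] -/
theorem dictP_aTop : dictP aTop 2 = -1 / 2 := by
  unfold dictP
  rw [update_bOfA_aTop, bOfA_aTop, rhoOf_aTop, coeff_bTop.2.1, coeff_bTop'.2.1, coeff_bTop.2.2, coeff_bTop'.2.2]
  norm_num

/-! ## 3. `D17` is a theorem -/

/-- **`D17`: the wedge dictionary holds at the level-1 top-pair point `(0,0,1,0,1,1,0,1)` with partner `2`** —
`I(0,0,1,0,1,1,0,1) = Q·θ − 4P̂_d·ζ(2) − 2P_d` with `(Q, P̂_d, P_d) = (0, 0, −1/2)`, i.e. `I = 1`, which is the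
analytic value `cellularIntegral_top17`.  HYPOTHESIS-FREE. [folklore] -/
theorem explicitPQAt_top17 : ExplicitPQAt ![0, 0, 1, 0, 1, 1, 0, 1] 2 := by
  unfold ExplicitPQAt
  rw [QOf_aTop, dictPhat_aTop, dictP_aTop, cellularIntegral_top17]
  push_cast
  ring

/-- The point lies in the region of the conjecture with partner `2` (so `D17` is a genuine instance of `explicitPQ`). [folklore] -/
theorem regionHyp_top17 : RegionHyp ![0, 0, 1, 0, 1, 1, 0, 1] 2 := by
  unfold RegionHyp; decide

/-! ## 4. Consequences: the dictionary ⟺ its two diagonal instances; `I_init → explicitPQ` -/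

/-- **gen-1's wedge conjecture `explicitPQ` (every admissible `a`) is EQUIVALENT to its two smallest DIAGONAL instances**
`a = 1⁸` and `a = 2⁸` (partner `1`) — HYPOTHESIS-FREE. [folklore] -/
theorem explicitPQ_iff_diag2 :
    explicitPQ ↔ (ExplicitPQAt ![1, 1, 1, 1, 1, 1, 1, 1] 1 ∧ ExplicitPQAt ![2, 2, 2, 2, 2, 2, 2, 2] 1) :=
  explicitPQ_iff_diag2_top.trans ⟨fun h => ⟨h.1, h.2.1⟩, fun h => ⟨h.1, h.2, explicitPQAt_top17⟩⟩

/-- **The same for the wedge-square dictionary** `wedgeDictionary`. [folklore] -/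
theorem wedgeDictionary_iff_diag2 :
    wedgeDictionary ↔ (ExplicitPQAt ![1, 1, 1, 1, 1, 1, 1, 1] 1 ∧ ExplicitPQAt ![2, 2, 2, 2, 2, 2, 2, 2] 1) :=
  wedgeDictionary_iff_explicitPQ.trans explicitPQ_iff_diag2

/-- **`explicitPQ` ⟺ the two remaining level-1 values** `D1 = ExplicitPQAt (1,0,1,0,1,1,1,1) 1` (axis point) and
`D2 = ExplicitPQAt (0,0,1,0,1,1,1,1) 2` (single-slot point) — HYPOTHESIS-FREE (`D17` discharged from `explicitPQ_iff_data3`). [folklore] -/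
theorem explicitPQ_iff_data2 :
    explicitPQ ↔ (ExplicitPQAt ![1, 0, 1, 0, 1, 1, 1, 1] 1 ∧ ExplicitPQAt ![0, 0, 1, 0, 1, 1, 1, 1] 2) :=
  explicitPQ_iff_data3.trans ⟨fun h => ⟨h.1, h.2.1⟩, fun h => ⟨h.1, h.2, explicitPQAt_top17⟩⟩

/-- **Given Brown–Zudilin's printed `I₁, I₂` (`I_init`), gen-1's wedge dictionary `explicitPQ` holds at EVERY admissible `a`**
(CONDITIONAL on the named Literature fact `I_init` exactly as typed; the recursion `I_solvesRec` is not used). [folklore] -/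
theorem explicitPQ_of_I_init (h : I_init) : explicitPQ :=
  explicitPQ_of_I_init_top h explicitPQAt_top17

/-- **Given `I_init`, the wedge-square dictionary `wedgeDictionary` holds** (both conjuncts, every admissible `a`, every partner). [folklore] -/
theorem wedgeDictionary_of_I_init (h : I_init) : wedgeDictionary :=
  wedgeDictionary_iff_explicitPQ.2 (explicitPQ_of_I_init h)

end Summit.KontsevichZagierPeriods.Zeta5Search.WedgeDictionaryTopPairDatum

end
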